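import Summits.AtomisticToContinuum.BoseEinsteinCondensation.Theorems.BECRichardsonGaudinRichardsonAnchorBECBornFixedBound
import Summits.AtomisticToContinuum.BoseEinsteinCondensation.Theorems.BECRichardsonGaudinRichardsonAnchorBECWindowLattice
import HarnessLib

/-!
# Crux `RichardsonAnchorBEC` (stmt-AtomisticToContinuum-14805), line `registered` — bookkeeping lemmas for the Born upper bound

Real-variable and lattice bookkeeping (worker of the lead, blueprint U6b) turning the fixed-parameter Born bound `stub_bornFixed` into the
eventual statement `stub_bornTrialState` (sequel file): `J_M − J_W = (1/2L³)Σ_{B_R∖0} 1/|k|²` and its bound, the window sum of `1/|k|⁴`,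
`p`-bounds, `Θ`, eventual largeness of `L` and `N`, the pure-real ε-budget `stub_bornBudget` (registered), the side conditions `be_params`.
-/

noncomputable section

namespace Summit.AtomisticToContinuum.BoseEinsteinCondensation.Cruxes.RichardsonAnchorBEC.Birth

open MeasureTheory Filter
open scoped ENNReal NNReal
open Literature.MathematicalPhysics.QuantumManyBody.BoseGas
open Summit.AtomisticToContinuum.BoseEinsteinCondensation.Theses.BECRichardsonGaudin
open Summit.AtomisticToContinuum.BoseEinsteinCondensation.Cruxes.PeriodicIRBound.LinearPhFloorWagner.WF (normSq innerRe)

/-- `J_M − J_W = (1/2L³) Σ_{m ∈ B_R ∖ 0} 1/‖k_m‖²` for `R ≤ M`: the band bubble minus the window bubble is the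
bubble of the punctured infrared cube (`B_M ∖ 0 = (B_M ∖ B_R) ⊔ (B_R ∖ 0)`). [folklore] -/
theorem be_bubble_sub {L : ℝ} (hL : 0 < L) {R M : ℕ} (hRM : R ≤ M) :
    bandBubble L M - windowBubble L M R =
      1 / (2 * L ^ 3) * ∑ m ∈ (momentumBand R).erase 0, 1 / ‖waveVector L m‖ ^ 2 := by
  have hB : bandBubble L M =
      1 / (2 * L ^ 3) * ∑ m ∈ (momentumBand M).erase 0, 1 / ‖waveVector L m‖ ^ 2 := by
    rw [sum_inv_norm_waveVector_sq hL.ne' M]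
    field_simp
  have hW : windowBubble L M R =
      1 / (2 * L ^ 3) * ∑ m ∈ momentumBand M \ momentumBand R, 1 / ‖waveVector L m‖ ^ 2 := rfl
  rw [hB, hW, ← mul_sub, Finset.sum_sdiff_eq_sub (wl_momentumBand_mono hRM),
    Finset.sum_erase_eq_sub (zero_mem_momentumBand M),
    Finset.sum_erase_eq_sub (zero_mem_momentumBand R)]
  ring

/-- For `R ≤ M`: `0 ≤ J_W ≤ J_M` and `J_M − J_W ≤ 13R/(4π²L)` (window lattice estimate (a)). [folklore] -/
theorem be_bubble_bounds {L : ℝ} (hL : 0 < L) {R M : ℕ} (hRM : R ≤ M) :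
    0 ≤ windowBubble L M R ∧ windowBubble L M R ≤ bandBubble L M ∧
      bandBubble L M - windowBubble L M R ≤ 13 * R / (4 * Real.pi ^ 2 * L) := by
  have hsub := be_bubble_sub hL hRM
  have h0 : 0 ≤ 1 / (2 * L ^ 3) * ∑ m ∈ (momentumBand R).erase 0, 1 / ‖waveVector L m‖ ^ 2 :=
    mul_nonneg (by positivity) (Finset.sum_nonneg fun m _ => by positivity)
  refine ⟨?_, by linarith, hsub ▸ wl_bandBubble_upper hL R⟩
  unfold windowBubble
  exact mul_nonneg (by positivity) (Finset.sum_nonneg fun m _ => bornPair_modeWeight_nonneg L m)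

/-- `Σ_{m ∈ B_M ∖ B_R} 1/‖k_m‖⁴ = 2 Σ_{m ∈ W₊} θ_m²` (window symmetry `m ↦ −m`, `θ_{−m} = θ_m`, `θ² = 1/‖k‖⁴`).
[folklore] -/
theorem be_window_sum_four (L : ℝ) (M R : ℕ) :
    ∑ m ∈ momentumBand M \ momentumBand R, 1 / ‖waveVector L m‖ ^ 4 =
      2 * ∑ m ∈ pairReps M R, modeWeight L m ^ 2 := by
  have h1 : ∑ m ∈ momentumBand M \ momentumBand R, 1 / ‖waveVector L m‖ ^ 4 =
      ∑ m ∈ pairWindow M R, modeWeight L m ^ 2 :=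
    Finset.sum_congr rfl fun m _ => by unfold modeWeight; ring
  rw [h1, BornPolyNorms.sum_pairWindow_eq_sum_pairReps, Finset.mul_sum]
  refine Finset.sum_congr rfl fun m _ => ?_
  unfold modeWeight
  rw [waveVector_neg, norm_neg]
  ring

/-- For `2R + 1 ≤ M`: `L⁴/(48π⁴(R+1)) ≤ p ≤ 13L⁴/(8π⁴(R+1))`, `p = Σ_{W₊} θ²` (window lattice estimates (c), (d)).
[folklore] -/
theorem be_p_bounds {L : ℝ} (hL : 0 < L) {R M : ℕ} (hM : 2 * R + 1 ≤ M) :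
    L ^ 4 / (48 * Real.pi ^ 4 * ((R : ℝ) + 1)) ≤ ∑ m ∈ pairReps M R, modeWeight L m ^ 2 ∧
      ∑ m ∈ pairReps M R, modeWeight L m ^ 2 ≤ 13 * L ^ 4 / (8 * Real.pi ^ 4 * ((R : ℝ) + 1)) := by
  have hc := wl_window_sum_upper hL R M
  have hd := wl_window_sum_lower hL hM
  rw [be_window_sum_four] at hc hd
  have hR1 : (0 : ℝ) < 48 * Real.pi ^ 4 * ((R : ℝ) + 1) := by positivity
  constructor
  · rw [div_le_iff₀ hR1]
    have := (div_le_iff₀ (by positivity)).1 hd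
    linarith
  · rw [le_div_iff₀ (by positivity)]
    have := (le_div_iff₀ (by positivity)).1 hc
    linarith

/-- On `W₊ ⊆ B_M ∖ B_R`: `θ_m ≤ L²/(4π²(R+1)²)` (window lattice estimate (b)). [folklore] -/
theorem be_theta {L : ℝ} (hL : 0 < L) (M R : ℕ) :
    ∀ m ∈ pairReps M R, modeWeight L m ≤ L ^ 2 / (4 * Real.pi ^ 2 * ((R : ℝ) + 1) ^ 2) := by
  intro m hm
  have hW : m ∈ momentumBand M \ momentumBand R := (stub_bornDefs M R).1 hm
  exact wl_inv_normSq_le hL (Finset.mem_sdiff.1 hW).2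

/-- `L_N(ρ) ≥ a` eventually in `N = n + 2`. [folklore] -/
theorem be_eventually_L {ρ : ℝ} (hρ : 0 < ρ) (a : ℝ) :
    ∀ᶠ n : ℕ in Filter.atTop, a ≤ sideLength ρ (n + 2) :=
  ((tendsto_sideLength_atTop hρ).comp (tendsto_add_atTop_nat 2)).eventually_ge_atTop a

/-- `N = n + 2 ≥ C` eventually. [folklore] -/
theorem be_eventually_N (C : ℝ) : ∀ᶠ n : ℕ in Filter.atTop, C ≤ ((n + 2 : ℕ) : ℝ) :=
  ((tendsto_natCast_atTop_atTop (R := ℝ)).comp (tendsto_add_atTop_nat 2)).eventually_ge_atTop C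

/-- **The ε-budget** (pure real arithmetic): with `X = γρN`, `0 ≤ J_W ≤ J_M`, `γ(J_M − J_W) ≤ 2ε/5`, `u ≤ 4ε/5`,
`0 ≤ δ ≤ min 1 (2ε/15)`, `t ≤ 2ε/5`, `4γρm ≤ Xε/5`:
`X/(2(1+γJ_W)) + (X/2)(u/2 + 2δ + δ² + t) + 4γρm ≤ X/(2(1+γJ_M)) + εX`. [folklore] -/
theorem stub_bornBudget :
    ∀ {γ ρ N ε JW JM u δ t m : ℝ} (hγ : 0 < γ) (hρ : 0 < ρ) (hN : 0 < N)
    (hJW : 0 ≤ JW) (hWM : JW ≤ JM) (hJ : γ * (JM - JW) ≤ 2 * ε / 5)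
    (hu : u ≤ 4 * ε / 5) (hδ0 : 0 ≤ δ) (hδ1 : δ ≤ 1) (hδ : δ ≤ 2 * ε / 15)
    (ht : t ≤ 2 * ε / 5) (hm : 4 * γ * ρ * m ≤ γ * ρ * N * (ε / 5)),
    γ * ρ * N / (2 * (1 + γ * JW)) + γ * ρ * N / 2 * (u / 2 + 2 * δ + δ ^ 2 + t) +
        4 * γ * ρ * m ≤
      γ * ρ * N / (2 * (1 + γ * JM)) + ε * (ρ * γ) * N := by
  intro γ ρ N ε JW JM u δ t m hγ hρ hN hJW hWM hJ hu hδ0 hδ1 hδ ht hm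
  have ha : 0 ≤ γ * JW := mul_nonneg hγ.le hJW
  have hb : 0 ≤ γ * JM := mul_nonneg hγ.le (hJW.trans hWM)
  have hW1 : 0 < 1 + γ * JW := by linarith
  have hM1 : 0 < 1 + γ * JM := by linarith
  have hfrac : 1 / (1 + γ * JW) ≤ 1 / (1 + γ * JM) + 2 * ε / 5 := by
    have hD : 1 ≤ (1 + γ * JW) * (1 + γ * JM) := by nlinarith [mul_nonneg ha hb]
    have key : 1 / (1 + γ * JW) - 1 / (1 + γ * JM) =
        γ * (JM - JW) / ((1 + γ * JW) * (1 + γ * JM)) := by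
      field_simp
      ring
    have h2 : γ * (JM - JW) / ((1 + γ * JW) * (1 + γ * JM)) ≤ γ * (JM - JW) :=
      div_le_self (mul_nonneg hγ.le (by linarith)) hD
    linarith
  have hδ2 : δ ^ 2 ≤ δ := by nlinarith
  have hX : 0 ≤ γ * ρ * N / 2 := by positivity
  have h1 : γ * ρ * N / (2 * (1 + γ * JW)) = γ * ρ * N / 2 * (1 / (1 + γ * JW)) := by
    rw [div_mul_div_comm, mul_one]
  have h2 : γ * ρ * N / (2 * (1 + γ * JM)) = γ * ρ * N / 2 * (1 / (1 + γ * JM)) := by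
    rw [div_mul_div_comm, mul_one]
  have step1 : γ * ρ * N / 2 * (1 / (1 + γ * JW)) ≤
      γ * ρ * N / 2 * (1 / (1 + γ * JM) + 2 * ε / 5) := mul_le_mul_of_nonneg_left hfrac hX
  have step2 : γ * ρ * N / 2 * (u / 2 + 2 * δ + δ ^ 2 + t) ≤ γ * ρ * N / 2 * (6 * ε / 5) :=
    mul_le_mul_of_nonneg_left (by linarith) hX
  rw [h1, h2]
  linarith

/-- `2R + 1 ≤ M` for `R = ⌊rL⌋`, `M = ⌊ΛL/2π⌋`, `r ≤ Λ/(8π)`, `L ≥ 4π/Λ`. [folklore] -/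
theorem be_RM {Λ r L : ℝ} (hΛ : 0 < Λ) (hL : 0 < L) (hr : 0 < r) (hrΛ : r ≤ Λ / (8 * Real.pi))
    (hL1 : 4 * Real.pi / Λ ≤ L) : 2 * ⌊r * L⌋₊ + 1 ≤ ⌊Λ * L / (2 * Real.pi)⌋₊ := by
  have hπ := Real.pi_pos
  refine Nat.le_floor ?_
  push_cast
  have hR_le : (⌊r * L⌋₊ : ℝ) ≤ r * L := Nat.floor_le (by positivity)
  have hΛL : 4 * Real.pi ≤ Λ * L := by
    have := (div_le_iff₀ hΛ).1 hL1
    linarith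
  have hr8 : r * (8 * Real.pi) ≤ Λ := (le_div_iff₀ (by positivity)).1 hrΛ
  have h1 : (⌊r * L⌋₊ : ℝ) * (8 * Real.pi) ≤ Λ * L := by
    calc (⌊r * L⌋₊ : ℝ) * (8 * Real.pi) ≤ r * L * (8 * Real.pi) := by gcongr
      _ = r * (8 * Real.pi) * L := by ring
      _ ≤ Λ * L := by gcongr
  rw [le_div_iff₀ (by positivity)]
  linarith

/-- `m = c²N²p ≤ C_m ρ N`, `C_m = 13γ²/(32π⁴r)`, from `c ≤ γ/(2L³)`, `p ≤ 13L⁴/(8π⁴(R+1))`, `rL ≤ R+1`, `N = ρL³`.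
[folklore] -/
theorem be_m_bound {γ ρ L N c p r R : ℝ} (hρ : 0 < ρ) (hL : 0 < L) (hr : 0 < r)
    (hR1 : 0 < R + 1) (hc0 : 0 ≤ c) (hcγ : c ≤ γ / (2 * L ^ 3)) (hp0 : 0 ≤ p)
    (hp_hi : p ≤ 13 * L ^ 4 / (8 * Real.pi ^ 4 * (R + 1))) (hRr : r * L ≤ R + 1)
    (hNρ : N = ρ * L ^ 3) :
    c ^ 2 * N ^ 2 * p ≤ 13 * γ ^ 2 / (32 * Real.pi ^ 4 * r) * ρ * N := by
  have hπ := Real.pi_pos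
  have hπ0 : Real.pi ≠ 0 := Real.pi_ne_zero
  have hL0 : L ≠ 0 := hL.ne'
  have hρ0 : ρ ≠ 0 := hρ.ne'
  have hr0 : r ≠ 0 := hr.ne'
  have hR10 : R + 1 ≠ 0 := hR1.ne'
  calc c ^ 2 * N ^ 2 * p
      ≤ (γ / (2 * L ^ 3)) ^ 2 * N ^ 2 * (13 * L ^ 4 / (8 * Real.pi ^ 4 * (R + 1))) := by gcongr
    _ ≤ (γ / (2 * L ^ 3)) ^ 2 * N ^ 2 * (13 * L ^ 4 / (8 * Real.pi ^ 4 * (r * L))) := by gcongr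
    _ = 13 * γ ^ 2 / (32 * Real.pi ^ 4 * r) * ρ * N := by
        rw [hNρ]
        field_simp
        ring

/-- `u = JΘ²/p ≤ 3J/(R+1)³ ≤ 3 J_b ρ/(r³N)` from `Θ = L²/(4π²(R+1)²)`, `p ≥ L⁴/(48π⁴(R+1))`, `rL ≤ R+1`, `J ≤ J_b`,
`N = ρL³`. [folklore] -/
theorem be_u_bound {J Jb Θ p L R r ρ N : ℝ} (hL : 0 < L) (hr : 0 < r) (hρ : 0 < ρ) (hN : 0 < N)
    (hR1 : 0 < R + 1) (hJ0 : 0 ≤ J) (hJb : J ≤ Jb) (hΘ : Θ = L ^ 2 / (4 * Real.pi ^ 2 * (R + 1) ^ 2))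
    (hp_lo : L ^ 4 / (48 * Real.pi ^ 4 * (R + 1)) ≤ p) (hRr : r * L ≤ R + 1) (hNρ : N = ρ * L ^ 3) :
    J * Θ ^ 2 / p ≤ 3 * Jb * ρ / (r ^ 3 * N) := by
  have hπ := Real.pi_pos
  have hπ0 : Real.pi ≠ 0 := Real.pi_ne_zero
  have hL0 : L ≠ 0 := hL.ne'
  have hρ0 : ρ ≠ 0 := hρ.ne'
  have hr0 : r ≠ 0 := hr.ne'
  have hR10 : R + 1 ≠ 0 := hR1.ne'
  have hN0 : N ≠ 0 := hN.ne'
  have hplo0 : 0 < L ^ 4 / (48 * Real.pi ^ 4 * (R + 1)) := by positivity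
  calc J * Θ ^ 2 / p ≤ J * Θ ^ 2 / (L ^ 4 / (48 * Real.pi ^ 4 * (R + 1))) :=
        div_le_div_of_nonneg_left (by positivity) hplo0 hp_lo
    _ = 3 * J / (R + 1) ^ 3 := by
        rw [hΘ]
        field_simp
        ring
    _ ≤ 3 * J / (r * L) ^ 3 := by gcongr
    _ = 3 * J * ρ / (r ^ 3 * N) := by
        rw [hNρ]
        field_simp
    _ ≤ 3 * Jb * ρ / (r ^ 3 * N) := by gcongr

/-- `δ = 2cJΘ ≤ γ J_b ρ/(4π²r²N)` from `c ≤ γ/(2L³)`, `Θ ≤ 1/(4π²r²)`, `J ≤ J_b`, `N = ρL³`. [folklore] -/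
theorem be_delta_bound {c J Jb Θ γ L r ρ N : ℝ} (hγ : 0 ≤ γ) (hL : 0 < L) (hr : 0 < r) (hρ : 0 < ρ)
    (hcγ : c ≤ γ / (2 * L ^ 3)) (hJ0 : 0 ≤ J) (hJb : J ≤ Jb) (hJb0 : 0 ≤ Jb)
    (hΘ0 : 0 ≤ Θ) (hΘr : Θ ≤ 1 / (4 * Real.pi ^ 2 * r ^ 2)) (hNρ : N = ρ * L ^ 3) :
    2 * c * J * Θ ≤ γ * Jb * ρ / (4 * Real.pi ^ 2 * r ^ 2 * N) := by
  have hπ0 : Real.pi ≠ 0 := Real.pi_ne_zero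
  have hL0 : L ≠ 0 := hL.ne'
  have hρ0 : ρ ≠ 0 := hρ.ne'
  have hr0 : r ≠ 0 := hr.ne'
  calc 2 * c * J * Θ ≤ 2 * (γ / (2 * L ^ 3)) * Jb * (1 / (4 * Real.pi ^ 2 * r ^ 2)) := by gcongr
    _ = γ * Jb * ρ / (4 * Real.pi ^ 2 * r ^ 2 * N) := by
        rw [hNρ]
        field_simp

/-- The two halves of a smallness budget: with `J_b = 2C_mρN + 1 + T`,
`K J_b ρ/(DN) = (2KC_mρ/D)ρ + K(1+T)ρ/(DN) ≤ κ + κ` once `2KC_mρ/D ≤ κ`, `ρ ≤ 1` and `K(1+T)ρ/(Dκ) ≤ N`. [folklore] -/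
theorem be_split {K D Cm ρ N T κ : ℝ} (hD : 0 < D) (hN : 0 < N) (hκ : 0 < κ) (hρ : 0 < ρ)
    (hρ1 : ρ ≤ 1) (h1 : K * (2 * Cm * ρ) / D ≤ κ) (h2 : K * (1 + T) * ρ / (D * κ) ≤ N) :
    K * (2 * (Cm * ρ * N) + 1 + T) * ρ / (D * N) ≤ 2 * κ := by
  have hD0 : D ≠ 0 := hD.ne'
  have hN0 : N ≠ 0 := hN.ne'
  have e : K * (2 * (Cm * ρ * N) + 1 + T) * ρ / (D * N) =
      K * (2 * Cm * ρ) / D * ρ + K * (1 + T) * ρ / (D * N) := by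
    field_simp
    ring
  have h1' : K * (2 * Cm * ρ) / D * ρ ≤ κ * 1 :=
    mul_le_mul h1 hρ1 hρ.le hκ.le
  have h2' : K * (1 + T) * ρ / (D * N) ≤ κ := by
    rw [div_le_iff₀ (by positivity)]
    have := (div_le_iff₀ (by positivity)).1 h2
    linarith
  linarith

/-- `γ(J_M − J_W) ≤ 2ε/5` from `J_M − J_W ≤ 13R/(4π²L)`, `R ≤ rL`, `r ≤ 8π²ε/(65γ)`. [folklore] -/
theorem be_J_bound {γ ε r L R JM JW : ℝ} (hγ : 0 < γ) (hL : 0 < L) (hRle : R ≤ r * L)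
    (hrε : r ≤ 8 * Real.pi ^ 2 * ε / (65 * γ)) (hJ : JM - JW ≤ 13 * R / (4 * Real.pi ^ 2 * L)) :
    γ * (JM - JW) ≤ 2 * ε / 5 := by
  have hπ := Real.pi_pos
  have hπ0 : Real.pi ≠ 0 := Real.pi_ne_zero
  have hL0 : L ≠ 0 := hL.ne'
  have hγ0 : γ ≠ 0 := hγ.ne'
  have h1 : JM - JW ≤ 2 * ε / (5 * γ) := by
    calc JM - JW ≤ 13 * R / (4 * Real.pi ^ 2 * L) := hJ
      _ ≤ 13 * (r * L) / (4 * Real.pi ^ 2 * L) := by gcongr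
      _ = 13 * r / (4 * Real.pi ^ 2) := by field_simp
      _ ≤ 13 * (8 * Real.pi ^ 2 * ε / (65 * γ)) / (4 * Real.pi ^ 2) := by gcongr
      _ = 2 * ε / (5 * γ) := by
          field_simp
          ring
  calc γ * (JM - JW) ≤ γ * (2 * ε / (5 * γ)) := mul_le_mul_of_nonneg_left h1 hγ.le
    _ = 2 * ε / 5 := by field_simp

/-- **The Born parameters at fixed `N`.** With `L > 0`, `L³ = N/ρ`, `M = ⌊ΛL/2π⌋`, `R = ⌊rL⌋`, `Θ = L²/(4π²(R+1)²)`,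
`p = Σ_{W₊} θ²`, `c = bornCoupling`, `m = c²N²p`, `J₁ = ⌈2m⌉ + T₁`, `C_m = 13γ²/(32π⁴r)`, the smallness of `ρ`
(`4C_mρ ≤ min (ε/5) (1/2)`, `6C_mρ/r³ ≤ κ₁`, `γC_mρ/(2π²r²) ≤ κ₂`) and the largeness of `N` (`L ≥ 4π/Λ`,
`3(1+T₁)ρ/(r³κ₁) ≤ N`, `γ(1+T₁)ρ/(4π²r²κ₂) ≤ N`, `2(4+2T₁) ≤ N`) give the side conditions of `bornFixedBound`
(`2J₁+2 ≤ N`, `T₁ ≤ J₁`, `2m ≤ J₁ − T₁`, `p > 0`, `u = J₁Θ²/p ≤ 1/2`, `θ ≤ Θ` on `W₊`) and the budget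
`γρN/(2(1+γJ_W)) + (γρN/2)(u/2 + 2δ + δ² + 2^{−T₁}) + 4γρm ≤ γρN/(2(1+γJ_M)) + εργN` (`δ = 2cJ₁Θ`), via the window
lattice estimates: `2R+1 ≤ M`, `γ(J_M − J_W) ≤ 13γr/(4π²) ≤ 2ε/5`, `L⁴/(48π⁴(R+1)) ≤ p ≤ 13L⁴/(8π⁴(R+1))`,
`m ≤ C_mρN`, `u ≤ 3J₁/(R+1)³ ≤ 2κ₁`, `δ ≤ γJ₁ρ/(4π²r²N) ≤ 2κ₂`. [folklore] -/
theorem be_params {γ Λ ε ρ r Cm κ₁ κ₂ L Θ : ℝ} {T₁ N M R J₁ : ℕ}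
    (hγ : 0 < γ) (hΛ : 0 < Λ) (hρ : 0 < ρ) (hρ1 : ρ ≤ 1) (hr : 0 < r)
    (hrΛ : r ≤ Λ / (8 * Real.pi)) (hrε : r ≤ 8 * Real.pi ^ 2 * ε / (65 * γ))
    (hCm : Cm = 13 * γ ^ 2 / (32 * Real.pi ^ 4 * r))
    (hκ₁ : 0 < κ₁) (hκ₁a : κ₁ ≤ 1 / 4) (hκ₁b : κ₁ ≤ 2 * ε / 5)
    (hκ₂ : 0 < κ₂) (hκ₂a : κ₂ ≤ 1 / 2) (hκ₂b : κ₂ ≤ ε / 15)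
    (hT₁ : (1 / 2 : ℝ) ^ T₁ ≤ 2 * ε / 5)
    (hρa : 4 * Cm * ρ ≤ ε / 5) (hρb : 4 * Cm * ρ ≤ 1 / 2)
    (hρc : 3 * (2 * Cm * ρ) / r ^ 3 ≤ κ₁) (hρd : γ * (2 * Cm * ρ) / (4 * Real.pi ^ 2 * r ^ 2) ≤ κ₂)
    (hL : 0 < L) (hLN : L ^ 3 = N / ρ) (hL1 : 4 * Real.pi / Λ ≤ L)
    (hN2 : 3 * (1 + T₁) * ρ / (r ^ 3 * κ₁) ≤ N)
    (hN3 : γ * (1 + T₁) * ρ / (4 * Real.pi ^ 2 * r ^ 2 * κ₂) ≤ N)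
    (hN4 : 2 * (4 + 2 * (T₁ : ℝ)) ≤ N)
    (hM : M = ⌊Λ * L / (2 * Real.pi)⌋₊) (hR : R = ⌊r * L⌋₊)
    (hΘ : Θ = L ^ 2 / (4 * Real.pi ^ 2 * ((R : ℝ) + 1) ^ 2))
    (hJ₁ : J₁ = ⌈2 * (bornCoupling γ L M R ^ 2 * (N : ℝ) ^ 2 *
      ∑ m ∈ pairReps M R, modeWeight L m ^ 2)⌉₊ + T₁) :
    2 * J₁ + 2 ≤ N ∧ T₁ ≤ J₁ ∧
    2 * (bornCoupling γ L M R ^ 2 * (N : ℝ) ^ 2 * ∑ m ∈ pairReps M R, modeWeight L m ^ 2) ≤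
        ((J₁ - T₁ : ℕ) : ℝ) ∧
    0 < ∑ m ∈ pairReps M R, modeWeight L m ^ 2 ∧
    (J₁ : ℝ) * Θ ^ 2 / (∑ m ∈ pairReps M R, modeWeight L m ^ 2) ≤ 1 / 2 ∧
    (∀ m ∈ pairReps M R, modeWeight L m ≤ Θ) ∧
    γ * ρ * (N : ℝ) / (2 * (1 + γ * windowBubble L M R)) +
        γ * ρ * (N : ℝ) / 2 *
          ((J₁ : ℝ) * Θ ^ 2 / (∑ m ∈ pairReps M R, modeWeight L m ^ 2) / 2 +
            2 * (2 * bornCoupling γ L M R * J₁ * Θ) + (2 * bornCoupling γ L M R * J₁ * Θ) ^ 2 +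
            (1 / 2 : ℝ) ^ T₁) +
        4 * γ * ρ * (bornCoupling γ L M R ^ 2 * (N : ℝ) ^ 2 * ∑ m ∈ pairReps M R, modeWeight L m ^ 2) ≤
      γ * ρ * (N : ℝ) / (2 * (1 + γ * bandBubble L M)) + ε * (ρ * γ) * (N : ℝ) := by
  have hπ := Real.pi_pos
  have hCm0 : 0 < Cm := by rw [hCm]; positivity
  -- `N = ρL³ > 0`
  have hNρ : (N : ℝ) = ρ * L ^ 3 := by rw [hLN, mul_div_cancel₀ _ hρ.ne']
  have hN0 : (0 : ℝ) < N := by rw [hNρ]; positivity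
  -- `R = ⌊rL⌋`, `2R + 1 ≤ M`
  have hR_le : (R : ℝ) ≤ r * L := by rw [hR]; exact Nat.floor_le (by positivity)
  have hR_lt : r * L ≤ (R : ℝ) + 1 := by rw [hR]; exact (Nat.lt_floor_add_one _).le
  have hR1 : (0 : ℝ) < (R : ℝ) + 1 := by positivity
  have hRM : 2 * R + 1 ≤ M := by rw [hM, hR]; exact be_RM hΛ hL hr hrΛ hL1
  have hRleM : R ≤ M := by omega
  -- the window lattice inputs
  obtain ⟨hp_lo, hp_hi⟩ := be_p_bounds hL hRM
  obtain ⟨hJW0, hWM, hJdiff0⟩ := be_bubble_bounds hL hRleM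
  have hc0 : 0 ≤ bornCoupling γ L M R := bornPair_bornCoupling_nonneg hγ.le hL M R
  have hcγ : bornCoupling γ L M R ≤ γ / (2 * L ^ 3) := by
    have h1 : 2 * L ^ 3 ≤ 2 * L ^ 3 * (1 + γ * windowBubble L M R) :=
      le_mul_of_one_le_right (by positivity) (le_add_of_nonneg_right (mul_nonneg hγ.le hJW0))
    unfold bornCoupling
    exact div_le_div_of_nonneg_left hγ.le (by positivity) h1
  have hθΘ' := be_theta hL M R
  -- abbreviations
  set p : ℝ := ∑ m ∈ pairReps M R, modeWeight L m ^ 2 with hp_def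
  set c : ℝ := bornCoupling γ L M R with hc_def
  set mm : ℝ := c ^ 2 * (N : ℝ) ^ 2 * p with hmm
  set JW : ℝ := windowBubble L M R with hJW_def
  set JM : ℝ := bandBubble L M with hJM_def
  clear_value p c mm JW JM
  clear hp_def hc_def hJW_def hJM_def
  -- `p > 0`
  have hp : 0 < p := lt_of_lt_of_le (by positivity) hp_lo
  -- `Θ`
  have hΘ0 : 0 ≤ Θ := by rw [hΘ]; positivity
  have hθΘ : ∀ m ∈ pairReps M R, modeWeight L m ≤ Θ := fun m hm => (hθΘ' m hm).trans_eq hΘ.symm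
  have hΘr : Θ ≤ 1 / (4 * Real.pi ^ 2 * r ^ 2) := by
    rw [hΘ, div_le_div_iff₀ (by positivity) (by positivity)]
    calc L ^ 2 * (4 * Real.pi ^ 2 * r ^ 2) = 4 * Real.pi ^ 2 * (r * L) ^ 2 := by ring
      _ ≤ 4 * Real.pi ^ 2 * ((R : ℝ) + 1) ^ 2 := by gcongr
      _ = 1 * (4 * Real.pi ^ 2 * ((R : ℝ) + 1) ^ 2) := by ring
  -- `m ≤ C_m ρ N`
  have hm0 : 0 ≤ mm := by
    rw [hmm]
    exact mul_nonneg (mul_nonneg (sq_nonneg _) (sq_nonneg _)) hp.le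
  have hmC : mm ≤ Cm * ρ * N := by
    rw [hmm, hCm]
    exact be_m_bound hρ hL hr hR1 hc0 hcγ hp.le hp_hi hR_lt hNρ
  -- `J₁ = ⌈2m⌉ + T₁`
  have hTJ : T₁ ≤ J₁ := by rw [hJ₁]; exact Nat.le_add_left _ _
  have h2m : 2 * mm ≤ ((J₁ - T₁ : ℕ) : ℝ) := by
    rw [hJ₁, Nat.add_sub_cancel]
    exact Nat.le_ceil _
  have hJ₁le : (J₁ : ℝ) ≤ 2 * mm + 1 + T₁ := by
    rw [hJ₁]
    push_cast
    have := Nat.ceil_lt_add_one (show (0 : ℝ) ≤ 2 * mm by positivity)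
    linarith only [this]
  clear hJ₁
  have hJ0 : (0 : ℝ) ≤ J₁ := Nat.cast_nonneg J₁
  have hJb0 : (0 : ℝ) ≤ 2 * (Cm * ρ * N) + 1 + T₁ := by positivity
  have hJJb : (J₁ : ℝ) ≤ 2 * (Cm * ρ * N) + 1 + T₁ := by linarith only [hJ₁le, hmC]
  -- `2J₁ + 2 ≤ N`
  have hJN : 2 * J₁ + 2 ≤ N := by
    have h4 : 4 * Cm * ρ * N ≤ 1 / 2 * N := mul_le_mul_of_nonneg_right hρb hN0.le
    have : (2 * J₁ + 2 : ℝ) ≤ N := by linarith only [hJ₁le, hmC, h4, hN4]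
    exact_mod_cast this
  -- `u = J₁Θ²/p ≤ 2κ₁`
  have hu3 := be_u_bound hL hr hρ hN0 hR1 hJ0 hJJb hΘ hp_lo hR_lt hNρ
  have hA := be_split (K := 3) (by positivity) hN0 hκ₁ hρ hρ1 hρc hN2
  have hu_half : (J₁ : ℝ) * Θ ^ 2 / p ≤ 1 / 2 := by linarith only [hu3, hA, hκ₁a]
  have hu45 : (J₁ : ℝ) * Θ ^ 2 / p ≤ 4 * ε / 5 := by linarith only [hu3, hA, hκ₁b]
  -- `δ = 2cJ₁Θ ≤ 2κ₂`
  have hδ0 : 0 ≤ 2 * c * J₁ * Θ := mul_nonneg (mul_nonneg (mul_nonneg zero_le_two hc0) hJ0) hΘ0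
  have hδb := be_delta_bound hγ.le hL hr hρ hcγ hJ0 hJJb hJb0 hΘ0 hΘr hNρ
  have hB := be_split (K := γ) (by positivity) hN0 hκ₂ hρ hρ1 hρd hN3
  have hδ1 : 2 * c * J₁ * Θ ≤ 1 := by linarith only [hδb, hB, hκ₂a]
  have hδε : 2 * c * J₁ * Θ ≤ 2 * ε / 15 := by linarith only [hδb, hB, hκ₂b]
  -- `γ(J_M − J_W) ≤ 2ε/5`
  have hJ : γ * (JM - JW) ≤ 2 * ε / 5 := be_J_bound hγ hL hR_le hrε hJdiff0
  -- `4γρm ≤ γρN · ε/5`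
  have hm4 : 4 * γ * ρ * mm ≤ γ * ρ * N * (ε / 5) := by
    have h1 : 4 * γ * ρ * mm ≤ 4 * γ * ρ * (Cm * ρ * N) :=
      mul_le_mul_of_nonneg_left hmC (by positivity)
    have h3 : γ * ρ * N * (4 * Cm * ρ) ≤ γ * ρ * N * (ε / 5) :=
      mul_le_mul_of_nonneg_left hρa (by positivity)
    linarith only [h1, h3]
  exact ⟨hJN, hTJ, h2m, hp, hu_half, hθΘ, stub_bornBudget hγ hρ hN0 hJW0 hWM hJ hu45 hδ0 hδ1 hδε hT₁ hm4⟩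

end Summit.AtomisticToContinuum.BoseEinsteinCondensation.Cruxes.RichardsonAnchorBEC.Birth

end
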